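import Summits.BirchSwinnertonDyer.Rank1Residual.Partition.CornersMultTargetA
import Summits.BirchSwinnertonDyer.Rank1Residual.Partition.CornersRiemannSumCertificate
import HarnessLib

/-!
# `p ≥ 5`, 'good ORDINARY, or MULTIPLICATIVE', analytic rank `≤ 1`, after the day's two closures of
# record: ONE Partition statement joining the X2a closure (`X2.TargetA`, referee A R199.2 / R201.2)
# and the Riemann-sum form of the type-B certificate (cell `b2b-bsdres`, RESIDUAL-MAP.md §A / §C
# corner predicates; rmap-1 gen 9 — the gen's joint closing form)

HONEST FRAMING (run/shared/lean/b2b/bsd-rank1-residual/, verbatim in every file): the goal of the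
cell is to DELETE the COMBINATION-SHAPED residual classes of the Birch–Swinnerton-Dyer formula for
ALL analytic-rank `≤ 1` elliptic curves over `ℚ` — "full BSD formula for every rank `≤ 1` curve in
class `C`" assembled STRICTLY from published theorems — so that the rank-`≤ 1` remainder becomes
exactly the CONSTRUCTION-SHAPED classes, which are TYPED (missing-input `Prop`s), NOT attempted.
This is not "finishing BSD". Theorems only; NO definition, NO named fact introduced here; every
published theorem enters as one of the tree's existing named Literature facts BY NAME; nothing
about any particular curve is asserted; no label changes; nothing is booked by this file.

## What this file records

cc-typer-6's `bsdp_goodOrd_or_mult_of_five_le_rankLeOne_of_certificates_cellC`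
(`Partition/CornersMultSchneiderCellC.lean`, twenty-one named facts) is the coordinator's domain at
`p ≥ 5` widened to both ranks on the multiplicative axis: granted the pair's Schneider certificate
(good-ordinary / non-split / split shapes) and, on X9, Greenberg's `μ = 0` + the unit-coefficient
certificate, `BSD(E,p)` unless `(X1 ∧ ¬gvpar) ∨ X11a ∨ (X2 off its rank-1 non-split GV-parity
sub-cell) ∨ (X11b ∧ ¬Ram)`. This file applies the two gen-9 landings to it:

* on the good ORDINARY branch outside X9 the Schneider binder is replaced by the IMPLICATION-SHAPED
  Riemann-sum certificate hypothesis of `CornersRiemannSumCertificate` (asked only on X1 ∧ gvpar;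
  consumer of `Literature/…/X1CoeffOneRiemannSumCertificate`, p265604); on X9 the rank-one road
  keeps its Schneider binder (`hSch9`, now asked only on X9) with `μ = 0` and the unit-coefficient
  certificate (`CornersGreenbergMu`);
* on the MULTIPLICATIVE branch the X2 corner shrinks on BOTH ranks by `CornersMultTargetA`'s
  `bsdp_mult_of_schneider_sharp_of_derivedFacts` (the X2a closure `X2.TargetA` and the Greenberg–
  Vatsal multiplicative clause both DISCHARGED from eisenstein-p2's derived-facts terms, p261163).

Result `bsdp_goodOrd_or_mult_of_five_le_rankLeOne_after_closures`: **non-CM `E/ℚ`, `p ≥ 5`, good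
ordinary or multiplicative at `p`, analytic rank `≤ 1`: `BSD(E,p)` unless
`(X1 ∧ ¬gvpar) ∨ X11a ∨ (X2 ∧ ¬(r = 0 ∧ gvpar) ∧ ¬(r = 1 ∧ ¬split ∧ gvpar)) ∨ (X11b ∧ ¬Ram)`**,
from THIRTY-ONE registered named facts and the per-pair inputs displayed as hypotheses, each asked
only where it is used: the Riemann-sum certificate on X1 ∧ gvpar; Greenberg's `μ = 0`, the
unit-coefficient certificate and the good-ordinary Schneider certificate on X9; the multiplicative
Schneider certificates (idle in rank `0`). Partition form
`bsdp_or_corner_goodOrd_or_mult_of_five_le_after_closures`. What does NOT shrink: the type-A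
Eisenstein-anomalous pairs (N1 / N1″), X9's `μ = 0` (N3), X11a (N7), X2b (N9) and X2c off its
non-split gvpar part (O9), X11b without a (ram) witness (N8's ¬ram atom), and the certificates.

References: RESIDUAL-MAP.md §A / §C corner predicates (rmap-1 g2–g9); `Partition/CornersSchneider`
(p247687), `CornersGreenbergMu` (p249603), `CornersMultSchneider` (p250379), cc-typer-6
`CornersMultSchneiderCellC` (p251198), `CornersMultTargetA` (p267398), `CornersRiemannSumCertificate`
(p268319); referee A ROUND 199 R199.2 / ROUND 201 R201.2.
-/

noncomputable section

open scoped Classical MatrixGroups ModularForm NumberField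

namespace Summit.BirchSwinnertonDyer.Rank1Residual

open CongruenceSubgroup WeierstrassCurve PowerSeries Literature.NumberTheory.EllipticCurves
  Literature.NumberTheory.EllipticCurves.Rank1Residual Literature.NumberTheory.EllipticCurves.ModularForms
  Literature.NumberTheory.EllipticCurves.Wuthrich2014
  Literature.NumberTheory.EllipticCurves.GreenbergVatsal2000
  Literature.NumberTheory.EllipticCurves.Rank1Residual.Typed
  Literature.NumberTheory.EllipticCurves.Skinner2016
  Literature.NumberTheory.EllipticCurves.SteinWuthrich2013
  Literature.NumberTheory.EllipticCurves.Disegni2020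

section Curve

variable {W : WeierstrassCurve ℚ} [W.IsElliptic] [W.IsGloballyMinimal] {p : ℕ} [Fact p.Prime]

/-- **Non-CM, `p ≥ 5`, 'good ORDINARY, or MULTIPLICATIVE', analytic rank `≤ 1`, after the X2a
closure and in Riemann-sum currency: THIRTY-ONE named facts.** `BSD(E,p)` unless `(E,p)` lies in
`X1 ∧ ¬gvpar` (type A), in X11a, in X2 outside both its rank-`0` GV-parity sub-cell and its
rank-`1` non-split GV-parity sub-cell, or in X11b without a (ram) witness — granted, each only
where used: on X1 ∧ gvpar a newform with a measure bound and ONE Riemann sum beating the truncation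
bound (`hcert1`); on X9 Greenberg's `μ = 0` (`hμ`), the unit-coefficient certificate (`hcert9`)
and the good-ordinary Schneider certificate (`hSch9`); at a multiplicative `p` the Schneider
certificates of the two multiplicative shapes (`hSchN` / `hSchS`, idle in rank `0`). Good ordinary:
`CornersRiemannSumCertificate` outside X9, `CornersGreenbergMu` on X9; multiplicative:
`CornersMultTargetA.bsdp_mult_of_schneider_sharp_of_derivedFacts`. [folklore] -/
theorem bsdp_goodOrd_or_mult_of_five_le_rankLeOne_after_closures
    (hBCS : BurungaleCastellaSkinner2025.cor131_padicValRat_bsd_rank_le_one)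
    (hBCSa : burungale_castella_skinner_charIdeal_eq_padicLFunction)
    (hGZK : rank_eq_analyticRank_of_analyticRank_le_one)
    (hCGS : CastellaGrossiSkinner2025.thmD_padicValRat_bsd_rank_le_one)
    (hGVg : GreenbergVatsal2000.thm13_charIdeal_eq_of_gvPar) (hGr : greenberg_charValue_rankZero)
    (hmod : hasEntireLFunction_rat) (hmodP : nonempty_modularParametrizationData)
    (hS : Schneider1985_order_charGenerator) (hPR : perrinRiou_rankOne_leadingTerms)
    (hΩ : realPeriodRat_eq_unit_mul_plusPeriod)
    (hSk : Skinner2016.thmC_padicValRat_bsd_rank_zero) (hA : thmA_charIdeal_multiplicative)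
    (hD : thm1_padicBSD_rankOne_multiplicative)
    (hT : Silverman1994_thmV53_tateUniformisation.{0})
    (hT' : Silverman1994_thmV53_corV54_tateUniformisation.{0})
    (hΛ : lambda_nonPrimitive_eq_add_sum_delta_multiplicative)
    (hB : datumSelmer_divisible_of_finite_torsionBy)
    (hF : datumStrictSelmer_lt_datumSelmer_of_split)
    (hLiftF : residualEpsilon_surjOn_of_lineRamifiedEven)
    (hP : cor38_realPeriodRat_eq_unit_mul_of_isIsogenous_of_gvPar)
    (hEx : exists_characterLFunction)
    (h311 : thm311_hasUnitContent_iff_and_order_eq_of_lineRamifiedEven)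
    (hLC : characterLFunctionC_hasUnitContent_and_order_eq_card)
    (hLD : characterLFunctionD_hasUnitContent_and_order_eq_card)
    (hWu : thm16_charIdeal_dvd_multiplicative_of_reducible)
    (hJs : thm61_splitMultiplicative) (hJn : thm61_nonsplitMultiplicative)
    (hHs : exists_isSplitMultCanonical) (hHn : exists_isMultCanonical)
    (hGS : ∀ (W : WeierstrassCurve ℚ) [W.IsElliptic] [W.IsGloballyMinimal] (p : ℕ) [Fact p.Prime],
      greenberg_stevens (W := W) (p := p))
    (hcm : ¬ W.HasCM) (hr : W.analyticRank ≤ 1) (h5 : 5 ≤ p) (hdom : GoodOrd W p ∨ Mult W p)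
    (hcert1 : ClassX1 W p → GVPar W p →
      ∃ (N : ℕ) (_ : NeZero N) (f : CuspForm (Gamma0 N) 2), IsNewformOf W f ∧
        ∃ (C : ℝ) (n : ℕ), (∀ (m : ℕ) (a : ZMod (p ^ m)), ‖msdMeasure f (unitRoot W p : ℚ_[p]) m a‖ ≤ C) ∧
          C * (p : ℝ) ^ (-n : ℤ) < ‖padicLRiemannSum f (unitRoot W p : ℚ_[p]) 1 n‖)
    (hμ : ClassX9 W p → ∀ (κ : ZpExtension ℚ p) (γ : Field.absoluteGaloisGroup ℚ),
        κ.IsCyclotomic → κ.IsTopGenerator γ → IsCyclotomicVariable p γ →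
      ∀ (D : W.SelmerDualData κ γ), D.mu = 0)
    (hcert9 : ClassX9 W p → ∀ [NeZero (W.conductorNorm ℤ)]
        (f : CuspForm (CongruenceSubgroup.Gamma0 (W.conductorNorm ℤ)) 2),
        IsNewformOf W f → ∀ (ϖ : ℚ), (ϖ : ℝ) * W.realPeriodRat = plusPeriod f →
      ∃ n : ℕ, ‖PowerSeries.coeff n
        (PowerSeries.C (ϖ : ℚ_[p]) * padicLFunction f (unitRoot W p : ℚ_[p]))‖ = 1)
    (hSch9 : ClassX9 W p → ∀ Dh : PAdicHeightData W p, Dh.IsCanonical → SchneiderConjecture Dh)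
    (hSchN : ∀ (q : ℚ_[p]) (Dh : PAdicHeightData W p), q ≠ 0 → ‖q‖ < 1 → tateJ q = (W.j : ℚ_[p]) →
      IsMultCanonical Dh q → SchneiderConjecture Dh)
    (hSchS : ∀ (Dq : TateParameterData W p) (Dh : PAdicHeightData W p),
      IsSplitMultCanonical Dh Dq → SchneiderConjecture Dh)
    (hA1 : ¬ (ClassX1 W p ∧ ¬ GVPar W p)) (hX11a : ¬ ClassX11a W p)
    (hX2 : ¬ (ClassX2 W p ∧ ¬ (W.analyticRank = 0 ∧ GVPar W p) ∧
      ¬ (W.analyticRank = 1 ∧ ¬ W.HasSplitMultiplicativeReductionAtPrime p ∧ GVPar W p)))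
    (hX11b : ¬ (ClassX11b W p ∧ ¬ Ram W p)) : BSDp W p := by
  rcases hdom with hgo | hm
  · by_cases hX9 : ClassX9 W p
    · haveI : NeZero (W.conductorNorm ℤ) := ⟨(W.conductorNorm_pos_holds).ne'⟩
      exact bsdp_of_classX9_of_greenbergMu_of_schneider hBCSa hGr hΩ hS hPR hmodP hmod hGZK hr hX9
        (hμ hX9) (fun f hf ϖ hϖ => hcert9 hX9 f hf ϖ hϖ) (hSch9 hX9)
    · exact bsdp_goodOrd_of_five_le_of_riemannSumCertificate_sharp hBCS hGZK hCGS hGVg hGr hmod hmodP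
        hS hPR hcm hr hgo h5 hcert1 hA1 hX9
  · refine bsdp_mult_of_schneider_sharp_of_derivedFacts hSk hA hD hT hT' hΛ hB hF hLiftF hP hEx h311
      hLC hLD hWu hJs hJn hHs hHn hGZK hmod hmodP hGS (by omega) hm hr hSchN hSchS hX11a hX2 ?_
    rintro ⟨hX, hnot⟩
    by_cases hram : Ram W p
    · exact hnot ⟨hram, fun _ => h5⟩
    · exact hX11b ⟨hX, hram⟩

/-- **Partition form, `p ≥ 5`, 'good ORDINARY, or MULTIPLICATIVE', rank `≤ 1`, after the closures:
`BSD(E,p) ∨ (X1 ∧ ¬gvpar) ∨ X11a ∨ (X2 ∧ ¬(r = 0 ∧ gvpar) ∧ ¬(r = 1 ∧ ¬split ∧ gvpar)) ∨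
(X11b ∧ ¬Ram)`** from the same thirty-one named facts and per-pair hypotheses. [folklore] -/
theorem bsdp_or_corner_goodOrd_or_mult_of_five_le_after_closures
    (hBCS : BurungaleCastellaSkinner2025.cor131_padicValRat_bsd_rank_le_one)
    (hBCSa : burungale_castella_skinner_charIdeal_eq_padicLFunction)
    (hGZK : rank_eq_analyticRank_of_analyticRank_le_one)
    (hCGS : CastellaGrossiSkinner2025.thmD_padicValRat_bsd_rank_le_one)
    (hGVg : GreenbergVatsal2000.thm13_charIdeal_eq_of_gvPar) (hGr : greenberg_charValue_rankZero)
    (hmod : hasEntireLFunction_rat) (hmodP : nonempty_modularParametrizationData)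
    (hS : Schneider1985_order_charGenerator) (hPR : perrinRiou_rankOne_leadingTerms)
    (hΩ : realPeriodRat_eq_unit_mul_plusPeriod)
    (hSk : Skinner2016.thmC_padicValRat_bsd_rank_zero) (hA : thmA_charIdeal_multiplicative)
    (hD : thm1_padicBSD_rankOne_multiplicative)
    (hT : Silverman1994_thmV53_tateUniformisation.{0})
    (hT' : Silverman1994_thmV53_corV54_tateUniformisation.{0})
    (hΛ : lambda_nonPrimitive_eq_add_sum_delta_multiplicative)
    (hB : datumSelmer_divisible_of_finite_torsionBy)
    (hF : datumStrictSelmer_lt_datumSelmer_of_split)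
    (hLiftF : residualEpsilon_surjOn_of_lineRamifiedEven)
    (hP : cor38_realPeriodRat_eq_unit_mul_of_isIsogenous_of_gvPar)
    (hEx : exists_characterLFunction)
    (h311 : thm311_hasUnitContent_iff_and_order_eq_of_lineRamifiedEven)
    (hLC : characterLFunctionC_hasUnitContent_and_order_eq_card)
    (hLD : characterLFunctionD_hasUnitContent_and_order_eq_card)
    (hWu : thm16_charIdeal_dvd_multiplicative_of_reducible)
    (hJs : thm61_splitMultiplicative) (hJn : thm61_nonsplitMultiplicative)
    (hHs : exists_isSplitMultCanonical) (hHn : exists_isMultCanonical)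
    (hGS : ∀ (W : WeierstrassCurve ℚ) [W.IsElliptic] [W.IsGloballyMinimal] (p : ℕ) [Fact p.Prime],
      greenberg_stevens (W := W) (p := p))
    (hcm : ¬ W.HasCM) (hr : W.analyticRank ≤ 1) (h5 : 5 ≤ p) (hdom : GoodOrd W p ∨ Mult W p)
    (hcert1 : ClassX1 W p → GVPar W p →
      ∃ (N : ℕ) (_ : NeZero N) (f : CuspForm (Gamma0 N) 2), IsNewformOf W f ∧
        ∃ (C : ℝ) (n : ℕ), (∀ (m : ℕ) (a : ZMod (p ^ m)), ‖msdMeasure f (unitRoot W p : ℚ_[p]) m a‖ ≤ C) ∧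
          C * (p : ℝ) ^ (-n : ℤ) < ‖padicLRiemannSum f (unitRoot W p : ℚ_[p]) 1 n‖)
    (hμ : ClassX9 W p → ∀ (κ : ZpExtension ℚ p) (γ : Field.absoluteGaloisGroup ℚ),
        κ.IsCyclotomic → κ.IsTopGenerator γ → IsCyclotomicVariable p γ →
      ∀ (D : W.SelmerDualData κ γ), D.mu = 0)
    (hcert9 : ClassX9 W p → ∀ [NeZero (W.conductorNorm ℤ)]
        (f : CuspForm (CongruenceSubgroup.Gamma0 (W.conductorNorm ℤ)) 2),
        IsNewformOf W f → ∀ (ϖ : ℚ), (ϖ : ℝ) * W.realPeriodRat = plusPeriod f →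
      ∃ n : ℕ, ‖PowerSeries.coeff n
        (PowerSeries.C (ϖ : ℚ_[p]) * padicLFunction f (unitRoot W p : ℚ_[p]))‖ = 1)
    (hSch9 : ClassX9 W p → ∀ Dh : PAdicHeightData W p, Dh.IsCanonical → SchneiderConjecture Dh)
    (hSchN : ∀ (q : ℚ_[p]) (Dh : PAdicHeightData W p), q ≠ 0 → ‖q‖ < 1 → tateJ q = (W.j : ℚ_[p]) →
      IsMultCanonical Dh q → SchneiderConjecture Dh)
    (hSchS : ∀ (Dq : TateParameterData W p) (Dh : PAdicHeightData W p),
      IsSplitMultCanonical Dh Dq → SchneiderConjecture Dh) :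
    BSDp W p ∨ (ClassX1 W p ∧ ¬ GVPar W p) ∨ ClassX11a W p ∨
      (ClassX2 W p ∧ ¬ (W.analyticRank = 0 ∧ GVPar W p) ∧
        ¬ (W.analyticRank = 1 ∧ ¬ W.HasSplitMultiplicativeReductionAtPrime p ∧ GVPar W p)) ∨
      (ClassX11b W p ∧ ¬ Ram W p) := by
  by_cases hA1 : ClassX1 W p ∧ ¬ GVPar W p
  · exact Or.inr (Or.inl hA1)
  · by_cases hX11a : ClassX11a W p
    · exact Or.inr (Or.inr (Or.inl hX11a))
    · by_cases hX2 : ClassX2 W p ∧ ¬ (W.analyticRank = 0 ∧ GVPar W p) ∧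
          ¬ (W.analyticRank = 1 ∧ ¬ W.HasSplitMultiplicativeReductionAtPrime p ∧ GVPar W p)
      · exact Or.inr (Or.inr (Or.inr (Or.inl hX2)))
      · by_cases hX11b : ClassX11b W p ∧ ¬ Ram W p
        · exact Or.inr (Or.inr (Or.inr (Or.inr hX11b)))
        · exact Or.inl (bsdp_goodOrd_or_mult_of_five_le_rankLeOne_after_closures hBCS hBCSa hGZK hCGS
            hGVg hGr hmod hmodP hS hPR hΩ hSk hA hD hT hT' hΛ hB hF hLiftF hP hEx h311 hLC hLD hWu hJs
            hJn hHs hHn hGS hcm hr h5 hdom hcert1 hμ hcert9 hSch9 hSchN hSchS hA1 hX11a hX2 hX11b)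

end Curve

end Summit.BirchSwinnertonDyer.Rank1Residual
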